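import Literature.AnabelianGeometry.SemiGraphs.TemperedMaximalCompactOfStabilizerLevel
import Literature.AnabelianGeometry.SemiGraphs.TemperedLevelKernelCharOpenCore
import Literature.AnabelianGeometry.SemiGraphs.TemperedEdgeLikeDistinctProofs
import Literature.AnabelianGeometry.SemiGraphs.TemperedChartTransport
import Literature.GroupTheory.ProPFrattiniNongenerating
import HarnessLib

/-!
# Verticial ⇒ maximal compact at a vertex with pro-`p` vertex group — any graph, any edge groups
# ([SemiAnbd] Thm 3.7 (iv) p. 41, «⇐» half; Prop 3.6 p. 38; Def 2.3 (iii), 2.4 (i) p. 25)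

Mochizuki, *Semi-graphs of anabelioids*, Publ. RIMS **42** (2006), Theorem 3.7 (iv) p. 41: "the maximal
compact subgroups of `π₁^temp(𝒢)` are precisely the verticial subgroups"
[cite: MochizukiSemiAnbd2006, Thm 3.7(iv) p.41]; the canonical tower of Prop. 3.6 p. 38 and the
quasi-coherence / elevation hypotheses of Def. 2.3 (iii) / 2.4 (i) p. 25.

PROOF-ONLY file (abc-iut cell, layer L3, row «T37iv-⇐@PRO-P-VERTEX» = abc-iut-w6-d064's banked successor
offer (b) «verticial ⇒ maximal compact for topologically f.g. PRO-`p` vertex groups and ARBITRARY edge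
groups, any graph — Frattini route»; seat abc-iut-L3-t6 gen 10; no definition, no named fact).  The cell's
∀-typing `MaximalCompactIffVerticial` (F-1750) is refuted as typed (p443103); its «⇐» half «every verticial
subgroup is a maximal compact subgroup» was proved at locally finite graphs (p449612), on the EDGE-side class
«TOP-CYCLIC» (p496768, abc-iut-w6-d064) and under NO-FIXED-EDGE (p495727).  Here: a VERTEX-side class.

1. `exists_level_stabilizer_mem_of_isOpen` — **point-stabiliser cofinality of the canonical tower at ONE
   vertex**: for every open `U ≤ Π_w`, from some level on the `Π_w`-stabiliser of every point of `(𝒢_n)_w`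
   lies in `U` (quasi-coherence applied to `Π_w/U` at `w` and the one-point coverings elsewhere,
   `Approximator.trivCov` (print's Prop. 2.5), abc-iut-L3-t6's `exists_level_splits_of_isFinite` — the tower
   eventually splits every FINITE covering — and `πV_eq_one_of_trivCov_ρ_eq`); `gal`-currency twin
   `exists_level_gal_eq_one_mem_of_isOpen`.  No strict coherence, no bound on the valence of `w`.
2. `exists_forall_inv_mul_conj_brHom_not_mem_of_nongenerating` — if `Φ ≤ Π_w` is NON-GENERATING for closed
   subgroups (`H` closed, `H ⊔ Φ = ⊤ ⇒ H = ⊤`) then no conjugate branch group supplements it: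
   `(f Π_b f⁻¹) · Φ ≠ Π_w` (`branchSubgroup_ne_top`, elevation) — the witnesses `hwit` of abc-iut-L3-t6's
   stabiliser-level criterion `isMaximalCompactSubgroup_of_forall_pointSeq_stabilizer_level` (p497081).
3. **`isMaximalCompactSubgroup_of_nongenerating_open`** (canonical chart) and
   **`TemperedPiChart.isMaximalCompactSubgroup_of_nongenerating_open`** (every chart): if `Π_w` has an OPEN
   subgroup which is non-generating for closed subgroups, every verticial subgroup at `w` is a MAXIMAL
   compact subgroup of `π₁^temp(𝒢)` — any countable `𝒢` with the hypotheses of Thm 3.7, any edge groups,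
   any valence at `w` (1 + 2 ⇒ p497081 ⇒ the Kőnig-free NOFIX criterion p495727).
4. **`TemperedPiChart.isMaximalCompactSubgroup_of_proP`** — in particular at every vertex whose `Π_w` is a
   topologically finitely generated PRO-`p` group (the Frattini core `Φ° = ⋂{open normal, index p}` is open
   and non-generating, `Literature.GroupTheory.exists_isOpen_nongenerating_of_proP`,
   `ProPFrattiniNongenerating.lean`); `…_of_isCoherent_of_proP` reads the finite generation off coherence
   (Def. 2.3 (iii)); `…_of_proP_vertices` — if EVERY vertex group is f.g. pro-`p_v` (the prime may depend
   on the vertex) the «⇐» half of Thm 3.7 (iv) holds at every vertex and every chart.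

Honest scope: the «⇒» half (every maximal compact subgroup is verticial) is NOT touched — it fails as typed
at the cell's counter-carriers (p443103, the rayless star); nothing here bears on [IUTchIII] Cor. 3.12; no
side taken; class-proved at OUR typing ≠ the print ∀.
-/

noncomputable section

namespace Literature.AnabelianGeometry.SemiGraphs

open CategoryTheory Topology

universe u

/-! ### 0. Transport of maximal compact subgroups (plumbing) -/

/-- Transport of maximal compact subgroups along a pair of mutually inverse continuous homomorphisms.
-- adapted from Literature/AnabelianGeometry/SemiGraphs/TemperedThm37iiiIffivExoticProcyclic.lean (private twin)
[cite: MochizukiSemiAnbd2006, Thm 3.7(iv) p.41] -/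
private theorem isMaximalCompactSubgroup_map_of_inverse' {A B : Type u} [Group A] [TopologicalSpace A]
    [Group B] [TopologicalSpace B] (φ : A →ₜ* B) (ψ : B →ₜ* A) (hψφ : ∀ x, ψ (φ x) = x)
    (hφψ : ∀ y, φ (ψ y) = y) {K : Subgroup A} (hK : IsMaximalCompactSubgroup K) :
    IsMaximalCompactSubgroup (K.map φ.toMonoidHom) := by
  refine ⟨?_, fun K' hK' hle => ?_⟩
  · rw [Subgroup.coe_map]
    exact hK.1.image φ.continuous
  · have hpre : IsCompact ((K'.map ψ.toMonoidHom : Subgroup A) : Set A) := by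
      rw [Subgroup.coe_map]
      exact hK'.image ψ.continuous
    have hle' : K ≤ K'.map ψ.toMonoidHom := fun k hk => ⟨φ k, hle ⟨k, hk, rfl⟩, hψφ k⟩
    have heq := hK.2 _ hpre hle'
    refine le_antisymm (fun y hy => ?_) hle
    have hy' : ψ y ∈ K := by
      rw [← heq]
      exact ⟨y, hy, rfl⟩
    exact ⟨ψ y, hy', hφψ y⟩

namespace ProfiniteSemiGraph

variable {𝒢 : ProfiniteSemiGraph.{u}}

/-! ### 1. Point-stabiliser cofinality of the canonical tower at one vertex -/

variable (𝒢) in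
/-- **Point stabilisers of the canonical tower are cofinal in the open subgroups of `Π_w`** (Prop. 3.6
p. 38 "cofinal"; Def. 2.3 (iii) quasi-coherence; Prop. 2.5): for every vertex `w` and every OPEN subgroup
`U ≤ Π_w` there is a level `n₀` such that for all `n ≥ n₀` the stabiliser in `Π_w` of EVERY point of the
fibre `(𝒢_n)_w` of the `n`-th level `𝒢_n` of the canonical Galois tower lies in `U`.  (Quasi-coherence
applied to the coset covering `Π_w/U` at `w` and the one-point coverings at the other constituents gives an
approximator whose vertex kernel at `w` lies in `U`; its trivialising covering is a FINITE covering of `𝒢`,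
split by the tower from some level on.)  No local finiteness, no strict coherence.
[cite: MochizukiSemiAnbd2006, Prop 3.6 p.38] -/
theorem exists_level_stabilizer_mem_of_isOpen (h36 : 𝒢.Prop36Hypotheses) (w : 𝒢.graph.Vertex)
    (U : Subgroup (𝒢.Gv w)) (hU : IsOpen (U : Set (𝒢.Gv w))) :
    ∃ n₀ : ℕ, ∀ n, n₀ ≤ n → ∀ (y : (((𝒢.galoisLevelData h36).S n).SV w).obj.V) (u : 𝒢.Gv w),
      (((𝒢.galoisLevelData h36).S n).SV w).obj.ρ u y = y → u ∈ U := by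
  classical
  haveI : Finite (𝒢.Gv w ⧸ U) := Subgroup.quotient_finite_of_isOpen U hU
  have hUi : U.index ≠ 0 := Subgroup.index_ne_zero_of_finite
  -- the family fed to quasi-coherence: `Π_w / U` at `w`, the one-point covering elsewhere
  let UV : ∀ v : 𝒢.graph.Vertex, Subgroup (𝒢.Gv v) := fun v => if h : w = v then h ▸ U else ⊤
  have hUVw : UV w = U := dif_pos rfl
  have hUVo : ∀ v, IsOpen (UV v : Set (𝒢.Gv v)) := by
    intro v
    by_cases h : w = v
    · subst h; rw [hUVw]; exact hU
    · simp only [UV, dif_neg h]; exact isOpen_univ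
  have hUVi : ∀ v, (UV v).index ≠ 0 := by
    intro v
    by_cases h : w = v
    · subst h; rw [hUVw]; exact hUi
    · simp only [UV, dif_neg h, Subgroup.index_top]; exact one_ne_zero
  have hUVM : ∀ v, (UV v).index ≤ max U.index 1 := by
    intro v
    by_cases h : w = v
    · subst h; rw [hUVw]; exact le_max_left _ _
    · simp only [UV, dif_neg h, Subgroup.index_top]; exact le_max_right _ _
  have hTo : ∀ e : 𝒢.graph.Edge, IsOpen ((⊤ : Subgroup (𝒢.Ge e)) : Set (𝒢.Ge e)) :=
    fun _ => isOpen_univ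
  have hTi : ∀ e : 𝒢.graph.Edge, (⊤ : Subgroup (𝒢.Ge e)).index ≠ 0 := fun _ => by
    rw [Subgroup.index_top]; exact one_ne_zero
  haveI : ∀ v, (UV v).FiniteIndex := fun v => ⟨hUVi v⟩
  haveI : ∀ e : 𝒢.graph.Edge, (⊤ : Subgroup (𝒢.Ge e)).FiniteIndex := fun e => ⟨hTi e⟩
  obtain ⟨A, hAV, -⟩ := h36.isQuasiCoherent (max U.index 1)
    (fun v => CovObj.cosetsObj (UV v) (hUVo v) (hUVi v))
    (fun e => CovObj.cosetsObj ⊤ (hTo e) (hTi e))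
    (fun v => ⟨hUVM v, inferInstanceAs (Finite (𝒢.Gv v ⧸ UV v))⟩)
    (fun e => ⟨by
      change (⊤ : Subgroup (𝒢.Ge e)).index ≤ max U.index 1
      rw [Subgroup.index_top]; exact le_max_right _ _,
      inferInstanceAs (Finite (𝒢.Ge e ⧸ (⊤ : Subgroup (𝒢.Ge e))))⟩)
  -- the trivialising covering of `A` is finite, hence split by the tower from some level on
  obtain ⟨M, hM, hdvd⟩ := A.bounded
  obtain ⟨n₀, hn₀⟩ :=
    𝒢.exists_level_splits_of_isFinite h36 (A.trivCov hM hdvd) (A.trivCov_isFinite hM hdvd)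
  refine ⟨n₀, fun n hn y u huy => ?_⟩
  obtain ⟨z⟩ := (A.trivCov_hasNonemptyFibres hM hdvd).nonempty_V w
  have huz := (hn₀ n hn).1 w y u huy z
  have hπ : A.πV w u = 1 := CovObj.πV_eq_one_of_trivCov_ρ_eq A hM hdvd w z u huz
  have huU : u ∈ UV w := CovObj.mem_of_cosetsObj_fixed (UV w) (hUVo w) (hUVi w) u (hAV w u hπ)
  rwa [hUVw] at huU

variable (𝒢) in
/-- The same in the currency of the decomposition homomorphisms `σ_n^•` at compatible point sequences
(abc-iut-L3-t6, `TemperedPiDecomposition.lean`): for every open `U ≤ Π_w`, from some level on the level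
kernels `{u | σ_n^u = 1}` of ALL point sequences over `w` lie in `U`.
[cite: MochizukiSemiAnbd2006, Prop 3.6 p.38] -/
theorem exists_level_gal_eq_one_mem_of_isOpen (h36 : 𝒢.Prop36Hypotheses) (w : 𝒢.graph.Vertex)
    (U : Subgroup (𝒢.Gv w)) (hU : IsOpen (U : Set (𝒢.Gv w))) :
    ∃ n₀ : ℕ, ∀ n, n₀ ≤ n → ∀ (T : (𝒢.galoisLevelData h36).PointSeq h36.isCountable w) (u : 𝒢.Gv w),
      T.gal n u = 1 → u ∈ U := by
  obtain ⟨n₀, hn₀⟩ := 𝒢.exists_level_stabilizer_mem_of_isOpen h36 w U hU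
  refine ⟨n₀, fun n hn T u h1 => ?_⟩
  have hfix := T.ρ_map_pt_eq_self_of_gal_eq_one n
    (((𝒢.galoisLevelData h36).S n).univCoverOverProj (Sum.inl ((𝒢.galoisLevelData h36).W n))
      h36.isCountable) u h1
  exact hn₀ n hn _ u hfix

/-! ### 2. Non-generating subgroups are supplemented by no conjugate branch group -/

/-- **No conjugate branch group supplements a non-generating subgroup** (Def. 2.4 (i) elevation): if
`Φ ≤ Π_w` is non-generating for closed subgroups — `H` closed and `H ⊔ Φ = Π_w` force `H = Π_w` — then for
every branch `b` at `w` and every `f ∈ Π_w` some `h ∈ Π_w` avoids the set `(f Π_b f⁻¹) · Φ`: the conjugate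
branch group `f Π_b f⁻¹` is closed (continuous image of the compact `Π_e`) and proper
(`branchSubgroup_ne_top`).  This is the witness clause `hwit` of
`isMaximalCompactSubgroup_of_forall_pointSeq_stabilizer_level`. [cite: MochizukiSemiAnbd2006, Def 2.4(i) p.25] -/
theorem exists_forall_inv_mul_conj_brHom_not_mem_of_nongenerating (hel : 𝒢.IsTotallyElevated)
    {w : 𝒢.graph.Vertex} (Φ : Subgroup (𝒢.Gv w))
    (hΦ : ∀ H : Subgroup (𝒢.Gv w), IsClosed (H : Set (𝒢.Gv w)) → H ⊔ Φ = ⊤ → H = ⊤)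
    (b : 𝒢.graph.Branch) (hb : 𝒢.graph.abuts b = some w) (f : 𝒢.Gv w) :
    ∃ h : 𝒢.Gv w, ∀ k : 𝒢.Ge (𝒢.graph.edgeOf b), h⁻¹ * (f * 𝒢.brHom b w hb k * f⁻¹) ∉ Φ := by
  by_contra hall
  push Not at hall
  -- the conjugate branch group `f Π_b f⁻¹`
  set H : Subgroup (𝒢.Gv w) := (𝒢.branchSubgroup b w hb).map (MulAut.conj f).toMonoidHom with hH
  have hBc : IsCompact ((𝒢.branchSubgroup b w hb : Subgroup (𝒢.Gv w)) : Set (𝒢.Gv w)) := by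
    change IsCompact (((𝒢.brHom b w hb).toMonoidHom.range : Subgroup (𝒢.Gv w)) : Set (𝒢.Gv w))
    rw [MonoidHom.coe_range]
    exact isCompact_range (𝒢.brHom b w hb).continuous
  have hHc : IsClosed (H : Set (𝒢.Gv w)) := by
    refine IsCompact.isClosed ?_
    rw [hH, Subgroup.coe_map]
    exact hBc.image ((continuous_const.mul continuous_id).mul continuous_const)
  have hHne : H ≠ ⊤ := by
    intro htop
    apply branchSubgroup_ne_top hel hb
    have hfull : (⊤ : Subgroup (𝒢.Gv w)).map (MulAut.conj f).toMonoidHom = ⊤ := by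
      rw [← MonoidHom.range_eq_map]
      exact MonoidHom.range_eq_top.mpr (MulAut.conj f).surjective
    exact Subgroup.map_injective (MulAut.conj f).injective (htop.trans hfull.symm)
  have hsup : H ⊔ Φ = ⊤ := by
    rw [eq_top_iff]
    intro h _
    obtain ⟨k, hk⟩ := hall h
    have hx : f * 𝒢.brHom b w hb k * f⁻¹ ∈ H := ⟨𝒢.brHom b w hb k, ⟨k, rfl⟩, rfl⟩
    have hid : h = (f * 𝒢.brHom b w hb k * f⁻¹) * (h⁻¹ * (f * 𝒢.brHom b w hb k * f⁻¹))⁻¹ := by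
      group
    rw [hid]
    exact mul_mem (Subgroup.mem_sup_left hx) (Subgroup.mem_sup_right (inv_mem hk))
  exact hHne (hΦ H hHc hsup)

/-! ### 3. Verticial ⇒ maximal compact from an open non-generating subgroup of `Π_w` -/

/-- **Verticial ⇒ MAXIMAL compact at a vertex whose `Π_w` has an open subgroup non-generating for closed
subgroups** (canonical chart of Prop. 3.6; any countable `𝒢` with the hypotheses of Thm 3.7, ANY edge
groups, ANY valence at `w`): take a level `n₀` whose point stabilisers at `w` lie in `Φ` (§1); at that level
no conjugate branch group supplements the stabiliser (§2), which is abc-iut-L3-t6's stabiliser-level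
criterion `isMaximalCompactSubgroup_of_forall_pointSeq_stabilizer_level` (⇒ NOFIX ⇒ Kőnig-free maximality).
[cite: MochizukiSemiAnbd2006, Thm 3.7(iv) p.41] -/
theorem isMaximalCompactSubgroup_of_nongenerating_open (h37 : 𝒢.Thm37Hypotheses)
    {w : 𝒢.graph.Vertex} (Φ : Subgroup (𝒢.Gv w)) (hΦo : IsOpen (Φ : Set (𝒢.Gv w)))
    (hΦ : ∀ H : Subgroup (𝒢.Gv w), IsClosed (H : Set (𝒢.Gv w)) → H ⊔ Φ = ⊤ → H = ⊤)
    {V : Subgroup (𝒢.temperedPiChart h37.toProp36Hypotheses).G}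
    (hV : V ∈ verticialSubgroups (𝒢.temperedPiChart h37.toProp36Hypotheses) w) :
    IsMaximalCompactSubgroup V := by
  obtain ⟨n₀, hn₀⟩ := 𝒢.exists_level_stabilizer_mem_of_isOpen h37.toProp36Hypotheses w Φ hΦo
  exact isMaximalCompactSubgroup_of_forall_pointSeq_stabilizer_level h37 hV fun P _ =>
    ⟨n₀, Φ, fun u hu => hn₀ n₀ le_rfl _ u hu,
      fun b hb f => exists_forall_inv_mul_conj_brHom_not_mem_of_nongenerating
        h37.toProp36Hypotheses.isTotallyElevated Φ hΦ b hb f⟩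

/-- **The same at EVERY chart** `c` of `π₁^temp(𝒢)` (transport along the compatible isomorphism of charts,
`TemperedPiChart.exists_compatIso`, which matches verticial subgroups).
[cite: MochizukiSemiAnbd2006, Thm 3.7(iv) p.41] -/
theorem TemperedPiChart.isMaximalCompactSubgroup_of_nongenerating_open (h37 : 𝒢.Thm37Hypotheses)
    (c : TemperedPiChart 𝒢) {w : 𝒢.graph.Vertex} (Φ : Subgroup (𝒢.Gv w))
    (hΦo : IsOpen (Φ : Set (𝒢.Gv w)))
    (hΦ : ∀ H : Subgroup (𝒢.Gv w), IsClosed (H : Set (𝒢.Gv w)) → H ⊔ Φ = ⊤ → H = ⊤)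
    {V : Subgroup c.G} (hV : V ∈ verticialSubgroups c w) : IsMaximalCompactSubgroup V := by
  obtain ⟨φ, ψ, hψφ, hφψ, -, hψ⟩ :=
    TemperedPiChart.exists_compatIso (𝒢.temperedPiChart h37.toProp36Hypotheses) c
  have hV' : V.map ψ.toMonoidHom ∈ verticialSubgroups (𝒢.temperedPiChart h37.toProp36Hypotheses) w :=
    mem_verticialSubgroups_map ψ hψ hV
  have hmax := ProfiniteSemiGraph.isMaximalCompactSubgroup_of_nongenerating_open h37 Φ hΦo hΦ hV'
  have heq : (V.map ψ.toMonoidHom).map φ.toMonoidHom = V := by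
    ext y
    constructor
    · rintro ⟨_, ⟨z, hz, rfl⟩, rfl⟩
      change φ (ψ z) ∈ V
      rw [hφψ]
      exact hz
    · intro hy
      exact ⟨ψ y, ⟨y, hy, rfl⟩, hφψ y⟩
  rw [← heq]
  exact isMaximalCompactSubgroup_map_of_inverse' φ ψ hψφ hφψ hmax

/-! ### 4. Pro-`p` vertex groups -/

/-- **Verticial ⇒ MAXIMAL compact at a vertex with topologically finitely generated PRO-`p` vertex group**
— any countable `𝒢` satisfying the hypotheses of Thm 3.7, ANY edge groups, ANY valence, every chart: every
verticial subgroup of `π₁^temp(𝒢)` at such a vertex `w` is a maximal compact subgroup.  The open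
non-generating subgroup is the Frattini core `⋂{N ≤ Π_w open normal of index p}`
(`Literature.GroupTheory.exists_isOpen_nongenerating_of_proP`). [cite: MochizukiSemiAnbd2006, Thm 3.7(iv) p.41] -/
theorem TemperedPiChart.isMaximalCompactSubgroup_of_proP (h37 : 𝒢.Thm37Hypotheses)
    (c : TemperedPiChart 𝒢) {w : 𝒢.graph.Vertex} {p : ℕ} [Fact p.Prime]
    (hP : ∀ U : OpenNormalSubgroup (𝒢.Gv w), IsPGroup p (𝒢.Gv w ⧸ (U : Subgroup (𝒢.Gv w))))
    (hfg : ∃ S : Finset (𝒢.Gv w),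
      Dense ((Subgroup.closure (S : Set (𝒢.Gv w)) : Subgroup (𝒢.Gv w)) : Set (𝒢.Gv w)))
    {V : Subgroup c.G} (hV : V ∈ verticialSubgroups c w) : IsMaximalCompactSubgroup V := by
  obtain ⟨Φ, hΦo, -, hΦ⟩ := Literature.GroupTheory.exists_isOpen_nongenerating_of_proP hP hfg
  exact c.isMaximalCompactSubgroup_of_nongenerating_open h37 Φ hΦo hΦ hV

/-- The same with topological finite generation read off COHERENCE (Def. 2.3 (iii): "every `π̂₁(𝒢_c)` is
topologically finitely generated"). [cite: MochizukiSemiAnbd2006, Def 2.3(iii) p.25] -/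
theorem TemperedPiChart.isMaximalCompactSubgroup_of_isCoherent_of_proP (h37 : 𝒢.Thm37Hypotheses)
    (hcoh : 𝒢.IsCoherent) (c : TemperedPiChart 𝒢) {w : 𝒢.graph.Vertex} {p : ℕ} [Fact p.Prime]
    (hP : ∀ U : OpenNormalSubgroup (𝒢.Gv w), IsPGroup p (𝒢.Gv w ⧸ (U : Subgroup (𝒢.Gv w))))
    {V : Subgroup c.G} (hV : V ∈ verticialSubgroups c w) : IsMaximalCompactSubgroup V := by
  obtain ⟨Φ, hΦo, -, hΦ⟩ := Literature.GroupTheory.exists_isOpen_nongenerating_of_proP' hP (hcoh.2.1 w)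
  exact c.isMaximalCompactSubgroup_of_nongenerating_open h37 Φ hΦo hΦ hV

/-- **The «⇐» half of Thm 3.7 (iv) at every vertex of a coherent `𝒢` all of whose vertex groups are
pro-`p_v`** (the prime may depend on the vertex; e.g. maximal pro-`l` quotients of the dual semi-graph of
a pointed stable curve): every verticial subgroup of `π₁^temp(𝒢)` is a maximal compact subgroup — any
countable `𝒢` with the hypotheses of Thm 3.7, any edge groups, every chart.
[cite: MochizukiSemiAnbd2006, Thm 3.7(iv) p.41] -/
theorem TemperedPiChart.isMaximalCompactSubgroup_of_proP_vertices (h37 : 𝒢.Thm37Hypotheses)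
    (hcoh : 𝒢.IsCoherent) (p : 𝒢.graph.Vertex → ℕ) (hp : ∀ v, (p v).Prime)
    (hP : ∀ (v : 𝒢.graph.Vertex) (U : OpenNormalSubgroup (𝒢.Gv v)),
      IsPGroup (p v) (𝒢.Gv v ⧸ (U : Subgroup (𝒢.Gv v))))
    (c : TemperedPiChart 𝒢) {w : 𝒢.graph.Vertex} {V : Subgroup c.G}
    (hV : V ∈ verticialSubgroups c w) : IsMaximalCompactSubgroup V := by
  haveI : Fact (p w).Prime := ⟨hp w⟩
  exact c.isMaximalCompactSubgroup_of_isCoherent_of_proP h37 hcoh (hP w) hV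

end ProfiniteSemiGraph

end Literature.AnabelianGeometry.SemiGraphs

end
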